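import Summits.ResolutionOfSingularities.ResolutionOfSingularities.Theses.Valuative
import Summits.ResolutionOfSingularities.ResolutionOfSingularities.Theorems.ValuativeLuAlphaPTorsorDenseRangeFinal

/-!
# Skeleton (gen 2, reshape v6.9) — line `pfaff-line-log-final-forms` for the crux `Valuative.LuAlphaPTorsor` (stmt-0641)

Lead prover's work file (seat `…-0641-c6`, 2026-08-17). State of the line:

* LANDED (Theorems/ValuativeLuAlphaPTorsor*.lean, all `--supports 0641`): every reduction (closed
  point G, zero-dimensional G₂, birational exit, unit derivative, toroidal / monogenic / residue /
  value exits), every true range (base dimension `≤ 2`; discrete rank one in every dimension; ALL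
  Abhyankar places, all ranks, all ground fields; perfect `k`; separable residue field of `K` or of
  `K₀`), AND (this seat) the DENSE-ABHYANKAR RANGE of Knaf–Kuhlmann 2009 Thm. 1.5 in its sharpest
  form: relative local uniformization along every ZERO-DIMENSIONAL valuation ring `O ⊇ k` of `K/k`
  (any `k` of characteristic `p`) such that `K` is dense, for `v`, in a finitely generated subfield
  `F₀ ⊇ k` on which `O` is an Abhyankar place — NO separability hypotheses (waves 1–3: D1 p162656,
  D2 p162908, D3 p162780, D4 p162645, D5 p162855, DenseRange p163153; S1a p163921, S1b p164379, S2
  p163930, DenseRange2 p164647; R0, R1, R2 p164399, DenseRangeFinal — `denseRange3`,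
  `denseRange3_crux`, `luAlphaPTorsor_of_defectCoreFinal`, `luAlphaPTorsor_iff_defectCoreFinal`).
* OPEN (the ONLY stub): F⁹ `stub_defectCoreFinal` — zero-dimensional NON-Abhyankar valuation at a
  closed-point centre of dimension `≥ 3` of the regular base, not discrete of rank one, no unit
  derivative of `t^p`, `t^p` not a `p`-th power at the centre, and `K` NOT dense in any finitely
  generated Abhyankar subfunction field `F₀ ⊇ k`: value group not finitely generated, or residue
  field of infinite degree over `k`, or `K` immediate-but-not-dense over every Abhyankar skeleton
  (the room for DEFECT) — the frontier of local uniformization in positive characteristic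
  (dimension `3`: Cossart–Piltant 2008/2009/2019; dimension `≥ 4`:
  `Literature.Barriers.ResolutionOfSingularities.DimensionFourFrontier`).

`LuAlphaPTorsor_of` is `luAlphaPTorsor_of_defectCoreFinal stub_defectCoreFinal` (the whole
composition is the landed theorem; the crux is EQUIVALENT to F⁹ by `luAlphaPTorsor_iff_defectCoreFinal`).
-/

set_option linter.unusedVariables false
set_option linter.dupNamespace false

open IsLocalRing

namespace Summit.ResolutionOfSingularities.ResolutionOfSingularities.Cruxes.LuAlphaPTorsor.PfaffLine

open Summit.ResolutionOfSingularities.ResolutionOfSingularities.Theorems.PfaffLine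
open Literature.AlgebraicGeometry.Resolution

/-- Stub F⁹ (reshape v6.8/v6.9; OPEN — the research frontier): **the defect core.** The v6.4 core
F⁶ᵃ (closed-point centre of dimension `≥ 3` on the regular base, `O` zero-dimensional and NOT an
Abhyankar place of `K/k`, not discrete of rank one, no unit derivative of `t^p`, `t^p` not a
`p`-th power at the centre) with the extra hypothesis that `K` is NOT dense (for `v`) in any
finitely generated subfield `F₀ ⊇ k` on which `O` is an Abhyankar place (Knaf–Kuhlmann 2009
Thm. 1.5, landed as `denseRange3_crux`, no separability hypotheses). -/
theorem stub_defectCoreFinal :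
    ∀ p : ℕ, p.Prime → ∀ (k K : Type) [Field k] [CharP k p] [Field K] [Algebra k K] (O : ValuationSubring K) (A₀ : Subalgebra k K) (h₀ : A₀.toSubring ≤ O.toSubring) (t : K), A₀.FG → ∀ (htp : t ^ p ∈ A₀), IsFractionRing (Algebra.adjoin k (insert t (A₀ : Set K))) K → IsRegularLocalRing (Localization.AtPrime (Ideal.comap (Subring.inclusion h₀) (IsLocalRing.maximalIdeal O))) → (Ideal.comap (Subring.inclusion h₀) (IsLocalRing.maximalIdeal O)).IsMaximal → (∀ x : K, x ∈ O → ∃ f : Polynomial k, f ≠ 0 ∧ Polynomial.aeval x f ∈ O.nonunits) → ¬ ringKrullDim (Localization.AtPrime (Ideal.comap (Subring.inclusion h₀) (IsLocalRing.maximalIdeal O))) ≤ 2 → ¬ Literature.AlgebraicGeometry.Resolution.IsAbhyankarPlace O (algebraMap k K).fieldRange ⊤ → ¬ (∃ F₀ : Subfield K, (algebraMap k K).fieldRange ≤ F₀ ∧ Literature.AlgebraicGeometry.Resolution.FGOver (algebraMap k K).fieldRange F₀ ∧ Literature.AlgebraicGeometry.Resolution.IsAbhyankarPlace O (algebraMap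 k K).fieldRange F₀ ∧ ∀ x w : K, w ≠ 0 → ∃ a ∈ F₀, O.valuation (x - a) < O.valuation w) → ¬ (∃ π : K, π ≠ 0 ∧ O.valuation π < 1 ∧ ∀ z : K, z ≠ 0 → ∃ n : ℤ, O.valuation z = O.valuation π ^ n) → (∀ δ : Derivation ℤ (Localization.AtPrime (Ideal.comap (Subring.inclusion h₀) (IsLocalRing.maximalIdeal O))) (Localization.AtPrime (Ideal.comap (Subring.inclusion h₀) (IsLocalRing.maximalIdeal O))), ¬ IsUnit (δ (algebraMap A₀.toSubring (Localization.AtPrime (Ideal.comap (Subring.inclusion h₀) (IsLocalRing.maximalIdeal O))) ⟨t ^ p, htp⟩))) → (∀ c : Localization.AtPrime (Ideal.comap (Subring.inclusion h₀) (IsLocalRing.maximalIdeal O)), algebraMap A₀.toSubring (Localization.AtPrime (Ideal.comap (Subring.inclusion h₀) (IsLocalRing.maximalIdeal O))) ⟨t ^ p, htp⟩ ≠ c ^ p) → ∃ (A : Subalgebra k K) (h : A.toSubring ≤ O.toSubring), A₀ ≤ A ∧ t ∈ A ∧ A.FG ∧ IsFractionRing A K ∧ IsRegularLocalRing (Localization.AtPrime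 (Ideal.comap (Subring.inclusion h) (IsLocalRing.maximalIdeal O))) := by
  sorry

/-! ## Composition -/

/-- **The line closes the crux modulo its single open stub** F⁹ (reshape v6.9): everything else
is the landed theorem `luAlphaPTorsor_of_defectCoreFinal`. -/
theorem LuAlphaPTorsor_of :
    Summit.ResolutionOfSingularities.ResolutionOfSingularities.Theses.Valuative.LuAlphaPTorsor :=
  luAlphaPTorsor_of_defectCoreFinal stub_defectCoreFinal

end Summit.ResolutionOfSingularities.ResolutionOfSingularities.Cruxes.LuAlphaPTorsor.PfaffLine
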